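import Summits.BirchSwinnertonDyer.BirchSwinnertonDyer.Theorems.ManinLocalTwoThreeEtaQuotientsFifteen
import Literature.NumberTheory.EllipticCurves.ModularCurveSturmProofs
import HarnessLib

/-!
# Level 15: the weight-4 identity `G² = 2304A − 4032F − 20736C` in `M₄(Γ₀(15))` — the `q`-limit through `o(q⁹)` and Sturm

Cell bsd-f2-manin, route `ManinLocalTwoThree` (cruxes C2 `ManinOddAtFour` stmt-22967 / C3 `ManinPrimeToThreeAtNine` stmt-22968),
prover seat p3 gen 25; sequel to `…EtaQuotientsFifteen` (the players `𝓔 = x + 1 = η₃η₅⁵/(η₁η₁₅⁵)`, `A = φ₁₅²𝓔`, `F = φ₁₅²`,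
`C = φ₁₅²/𝓔`, `G = −E₂(τ) + 3E₂(3τ) + 25E₂(5τ) − 75E₂(15τ)` on `X₀(15) = 15a1`); the level-`15` twin of `…EtaIdentityFourteen`.

* §1 (L)₁₅: `(G² − 2304A + 4032F + 20736C)/q⁹ → 0` at `i∞` — ten `q`-coefficients, by the tree's `QRemainder` calculus on the
  Euler-function monomials (cleared by the unit `E₅³E₁₅³`; every power and product reduced modulo `X¹⁰` with an explicit
  quotient witness, seat script `work/l14/gen_limit2.py`);
* §2 Sturm in `M₄(Γ₀(15))` (`μ = 24`, `⌊4·24/12⌋ = 8 < 9`, tree `coe_eq_zero_of_isBigO_exp'`) ⟹ **`G² = 2304A − 4032F − 20736C`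
  on `ℍ`** (`G_sq_eq`), i.e. `G²𝓔 = 576φ₁₅²(4𝓔² − 7𝓔 − 36)` — the Weierstrass equation of `15a1` along the modular
  parametrisation, differentiated (`(2y + x + 1)² = 4x³ + 5x² − 38x − 39 = 𝓔(4𝓔² − 7𝓔 − 36)`, `𝓔′ = (πi/12)G𝓔`).

HONEST FRAMING: unconditional `q`-series analysis plus Sturm; nothing here proves C2, C3, Manin's conjecture or BSD; items 22967/22968
stay OPEN.  No definition, no named fact, no sorry. [cite: Zagier2008, §2.3] [cite: DiamondShurman2005, Thm. 3.5.1]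
[cite: CremonaAlgorithms1997, §2.10 and Table 1 (15a1)]
-/

set_option autoImplicit false
-- lint-debt: the directory name repeats the summit name (sibling precedent `ManinLocalTwoThreeEtaIdentityFourteen.lean`)
set_option linter.dupNamespace false

noncomputable section

open Complex Filter Topology Set Asymptotics Polynomial EisensteinSeries
open UpperHalfPlane hiding I
open scoped Real Topology Manifold MatrixGroups ModularForm
open ModularForm CongruenceSubgroup
open Literature.NumberTheory.ModularForms
open Literature.NumberTheory.EllipticCurves Literature.NumberTheory.EllipticCurves.ModularForms

namespace Summit.BirchSwinnertonDyer.BirchSwinnertonDyer.Theorems.ManinLocalTwoThree.EtaIdentityFifteen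

open QRemainder EulerRemainders EtaLogDerivativeForms EtaQuotientsFifteen

/-! ## §1 (L)₁₅: `G² − 2304A + 4032F + 20736C = o(q⁹)` -/

/-- **(L)₁₅: `(G² − 2304A + 4032F + 20736C)/q⁹ → 0` at `i∞`** (cleared by `E₅³E₁₅³`). [cite: Zagier2008, §2.3] -/
theorem tendsto_L :
    Tendsto (fun τ : ℍ ↦ ((-E2 (sixMulPt 1 τ) + 3 * E2 (sixMulPt 3 τ) + 25 * E2 (sixMulPt 5 τ) - 75 * E2 (sixMulPt 15 τ)) ^ 2
      - 2304 * etaQuotient 15 (expFn [(1, 1), (3, 3), (5, 7), (15, -3)]) τ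
      + 4032 * etaQuotient 15 (expFn [(1, 2), (3, 2), (5, 2), (15, 2)]) τ
      + 20736 * etaQuotient 15 (expFn [(1, 3), (3, 1), (5, -3), (15, 7)]) τ)
      / Function.Periodic.qParam 1 (τ : ℂ) ^ 9) atImInfty (𝓝 0) := by
  have hE1 := EulerRemaindersForty.tendsto_eulerFn_one_nine
  have hE2 := tendsto_eulerFn_three_nine
  have hEp := EulerRemaindersForty.tendsto_eulerFn_five_nine
  have hEpp := tendsto_eulerFn (δ := 15) (m := 9) (by norm_num)
  have hG := QRemainder.sub (QRemainder.sub (QRemainder.add (QRemainder.const_mul 3 tendsto_E2_three_nine)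
    (QRemainder.const_mul 25 tendsto_E2_five_nine)) (QRemainder.const_mul 75 tendsto_E2_fifteen_nine)) EtaQuotientsFourteen.tendsto_E2_one_nine
  have hG2 := QRemainder.pow hG 2
  have hG2r := QRemainder.reduce (2304 - 2304 * X - 6336 * X ^ 2 + 1152 * X ^ 3 - 9792 * X ^ 4 + 55296 * X ^ 5 - 4032 * X ^ 6 - 72576 * X ^ 7 - 8640 * X ^ 8 - 107136 * X ^ 9) (294336 + 19584 * X - 47808 * X ^ 2 - 292608 * X ^ 3 + 66816 * X ^ 4 + 141696 * X ^ 5 + 138816 * X ^ 6 + 17280 * X ^ 7 + 576 * X ^ 8)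
    (by simp only [map_ofNat]; ring) hG2
  have hE2_3 := QRemainder.pow hE2 3
  have hE2_3r := QRemainder.reduce (1 - 3 * X ^ 3 + 5 * X ^ 9) (-3 * X ^ 5 - X ^ 8)
    (by ring) hE2_3
  have hm1 := QRemainder.mul hE1 hE2_3r
  have hm1r := QRemainder.reduce (1 - X - X ^ 2 - 3 * X ^ 3 + 3 * X ^ 4 + 4 * X ^ 5 + X ^ 7 - 3 * X ^ 8 + 5 * X ^ 9) (-8 - 5 * X + 5 * X ^ 4 + 5 * X ^ 6)
    (by ring) hm1
  have hEp_10 := QRemainder.pow hEp 10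
  have hEp_10r := QRemainder.reduce (1 - 10 * X ^ 5) (45 - 120 * X ^ 5 + 210 * X ^ 10 - 252 * X ^ 15 + 210 * X ^ 20 - 120 * X ^ 25 + 45 * X ^ 30 - 10 * X ^ 35 + X ^ 40)
    (by ring) hEp_10
  have hm2 := QRemainder.mul hm1r hEp_10r
  have hm2r := QRemainder.reduce (1 - X - X ^ 2 - 3 * X ^ 3 + 3 * X ^ 4 - 6 * X ^ 5 + 10 * X ^ 6 + 11 * X ^ 7 + 27 * X ^ 8 - 25 * X ^ 9) (-40 - 10 * X ^ 2 + 30 * X ^ 3 - 50 * X ^ 4)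
    (by ring) hm2
  have hE1_2 := QRemainder.pow hE1 2
  have hE1_2r := QRemainder.reduce (1 - 2 * X - X ^ 2 + 2 * X ^ 3 + X ^ 4 + 2 * X ^ 5 - 2 * X ^ 6 - 2 * X ^ 8 - 2 * X ^ 9) (1 + 2 * X ^ 2 + X ^ 4)
    (by ring) hE1_2
  have hE2_2 := QRemainder.pow hE2 2
  have hE2_2r := QRemainder.reduce (1 - 2 * X ^ 3 - X ^ 6 + 2 * X ^ 9) (X ^ 2)
    (by ring) hE2_2
  have hm3 := QRemainder.mul hE1_2r hE2_2r
  have hm3r := QRemainder.reduce (1 - 2 * X - X ^ 2 + 5 * X ^ 4 + 4 * X ^ 5 - 7 * X ^ 6 - 5 * X ^ 8 + 2 * X ^ 9) (-5 + 10 * X ^ 2 + 2 * X ^ 3 + 6 * X ^ 4 - 2 * X ^ 5 - 4 * X ^ 7 - 4 * X ^ 8)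
    (by ring) hm3
  have hEp_5 := QRemainder.pow hEp 5
  have hEp_5r := QRemainder.reduce (1 - 5 * X ^ 5) (10 - 10 * X ^ 5 + 5 * X ^ 10 - X ^ 15)
    (by ring) hEp_5
  have hm4 := QRemainder.mul hm3r hEp_5r
  have hm4r := QRemainder.reduce (1 - 2 * X - X ^ 2 + 5 * X ^ 4 - X ^ 5 + 3 * X ^ 6 + 5 * X ^ 7 - 5 * X ^ 8 - 23 * X ^ 9) (-20 + 35 * X + 25 * X ^ 3 - 10 * X ^ 4)
    (by ring) hm4
  have hEpp_5 := QRemainder.pow hEpp 5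
  have hm5 := QRemainder.mul hm4r hEpp_5
  have hq6 := QRemainder.qParam_pow_mul 2 hm5
  have hq6r := QRemainder.reduce (X ^ 2 - 2 * X ^ 3 - X ^ 4 + 5 * X ^ 6 - X ^ 7 + 3 * X ^ 8 + 5 * X ^ 9) (-5 - 23 * X)
    (by ring) hq6
  have hE1_3 := QRemainder.pow hE1 3
  have hE1_3r := QRemainder.reduce (1 - 3 * X + 5 * X ^ 3 - 7 * X ^ 6) (9 + 3 * X ^ 2 - 6 * X ^ 3 - 3 * X ^ 4 - 2 * X ^ 5 - 3 * X ^ 6 + 3 * X ^ 7 + 3 * X ^ 9 + X ^ 11)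
    (by ring) hE1_3
  have hm7 := QRemainder.mul hE1_3r hE2
  have hm7r := QRemainder.reduce (1 - 3 * X + 4 * X ^ 3 + 3 * X ^ 4 - 13 * X ^ 6 + 3 * X ^ 7 + 2 * X ^ 9) (7 * X ^ 2)
    (by ring) hm7
  have hEpp_10 := QRemainder.pow hEpp 10
  have hm8 := QRemainder.mul hm7r hEpp_10
  have hq9 := QRemainder.qParam_pow_mul 4 hm8
  have hq9r := QRemainder.reduce (X ^ 4 - 3 * X ^ 5 + 4 * X ^ 7 + 3 * X ^ 8) (-13 + 3 * X + 2 * X ^ 3)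
    (by ring) hq9
  have hEp_3 := QRemainder.pow hEp 3
  have hEp_3r := QRemainder.reduce (1 - 3 * X ^ 5) (3 - X ^ 5)
    (by ring) hEp_3
  have hEpp_3 := QRemainder.pow hEpp 3
  have hm10 := QRemainder.mul hEp_3r hEpp_3
  have ht1 := QRemainder.mul hG2r hm10
  have ht1r := QRemainder.reduce (2304 - 2304 * X - 6336 * X ^ 2 + 1152 * X ^ 3 - 9792 * X ^ 4 + 48384 * X ^ 5 + 2880 * X ^ 6 - 53568 * X ^ 7 - 12096 * X ^ 8 - 77760 * X ^ 9) (-165888 + 12096 * X + 217728 * X ^ 2 + 25920 * X ^ 3 + 321408 * X ^ 4)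
    (by ring) ht1
  have hv11 := QRemainder.sub ht1r (QRemainder.const_mul 2304 hm2r)
  have hv12 := QRemainder.add hv11 (QRemainder.const_mul 4032 hq6r)
  have hv13 := QRemainder.add hv12 (QRemainder.const_mul 20736 hq9r)
  have hV := QRemainder.reduce 0 (0)
    (by simp only [map_ofNat]; ring) hv13
  have hlim := (QRemainder.tendsto_div_pow 9 le_rfl hV).mul
    ((((isIntUnitQExp_eulerFn (by norm_num : 0 < 5)).tendsto_one.pow 3).mul
      ((isIntUnitQExp_eulerFn (by norm_num : 0 < 15)).tendsto_one.pow 3)).inv₀ (by norm_num))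
  rw [zero_mul] at hlim
  refine hlim.congr fun τ ↦ ?_
  have hE5' := eulerFn_ne_zero (by norm_num : 0 < 5) τ
  have hE15' := eulerFn_ne_zero (by norm_num : 0 < 15) τ
  have hq := qParam_ne_zero τ
  rw [A_eq, F_eq, C_eq]
  field_simp
  ring

/-! ## §2 Sturm in `M₄(Γ₀(15))` and the identity -/

/-- `μ(Γ₀(15)) = μ(3)·μ(5) = 4·6 = 24`. [cite: DiamondShurman2005, §3.8] -/
theorem gamma0Index_fifteen : gamma0Index 15 = 24 := by
  rw [show (15 : ℕ) = 3 * 5 by norm_num, gamma0Index_mul (m := 3) (n := 5) (by norm_num), gamma0Index_prime Nat.prime_three,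
    gamma0Index_prime (by norm_num)]

/-- **Sturm's bound in `M₄(Γ₀(15))`: `T/q⁹ → 0` at `i∞` forces `T = 0`** (`⌊4·24/12⌋ = 8 < 9`). [cite: DiamondShurman2005, Thm. 3.5.1] -/
theorem modularForm_fifteen_four_eq_zero_of_tendsto (T : ModularForm (Gamma0 15) (2 + 2))
    (h : Tendsto (fun τ : ℍ ↦ T τ / Function.Periodic.qParam 1 (τ : ℂ) ^ 9) atImInfty (𝓝 0)) : (⇑T) = 0 := by
  have hcard : Nat.card (𝒮ℒ ⧸ ((Gamma0 15 : Subgroup SL(2, ℤ)) : Subgroup (GL (Fin 2) ℝ)).subgroupOf 𝒮ℒ) = 24 := by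
    rw [card_quotient_subgroupOf_eq_index]
    have h1 := index_gamma0_eq_gamma0Index_holds 15
    unfold index_gamma0_eq_gamma0Index at h1
    rw [h1, gamma0Index_fifteen]
  refine coe_eq_zero_of_isBigO_exp' T (m := 9) ?_ (by
    rw [hcard]
    simp only [Int.reduceAdd, Int.reduceMul, Int.reduceToNat, Nat.reduceDiv, Nat.cast_ofNat]
    norm_num)
  have h1 : (fun τ : ℍ ↦ T τ / Function.Periodic.qParam 1 (τ : ℂ) ^ 9) =O[atImInfty] fun _ : ℍ ↦ (1 : ℝ) := h.isBigO_one ℝ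
  have h2 : (fun τ : ℍ ↦ Function.Periodic.qParam 1 (τ : ℂ) ^ 9) =O[atImInfty] fun τ : ℍ ↦ Real.exp (-2 * π * 9 * τ.im) := by
    refine Asymptotics.IsBigO.of_bound 1 (Filter.Eventually.of_forall fun τ ↦ ?_)
    rw [norm_pow, Function.Periodic.norm_qParam, Real.norm_eq_abs, abs_of_pos (Real.exp_pos _), one_mul,
      ← Real.exp_nat_mul, UpperHalfPlane.coe_im]
    apply le_of_eq
    congr 1
    push_cast
    ring
  have h3 := h1.mul h2
  simp only [one_mul] at h3
  refine h3.congr' (Filter.Eventually.of_forall fun τ ↦ ?_) Filter.EventuallyEq.rfl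
  exact div_mul_cancel₀ _ (pow_ne_zero _ (qParam_ne_zero τ))

/-- **`G² = 2304A − 4032F − 20736C` on `ℍ`** — the identity in `M₄(Γ₀(15))` (Sturm + (L)₁₅). [cite: DiamondShurman2005, Thm. 3.5.1] -/
theorem G_sq_eq (τ : ℍ) :
    (-E2 (sixMulPt 1 τ) + 3 * E2 (sixMulPt 3 τ) + 25 * E2 (sixMulPt 5 τ) - 75 * E2 (sixMulPt 15 τ)) ^ 2
      = 2304 * etaQuotient 15 (expFn [(1, 1), (3, 3), (5, 7), (15, -3)]) τ
        - 4032 * etaQuotient 15 (expFn [(1, 2), (3, 2), (5, 2), (15, 2)]) τ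
        - 20736 * etaQuotient 15 (expFn [(1, 3), (3, 1), (5, -3), (15, 7)]) τ := by
  obtain ⟨G, hG⟩ := exists_modularForm_G
  obtain ⟨FA, hA⟩ := exists_modularForm_A
  obtain ⟨FF, hF⟩ := exists_modularForm_F
  obtain ⟨FC, hC⟩ := exists_modularForm_C
  set T : ModularForm (Gamma0 15) (2 + 2) :=
    G.mul G - ((2304 : ℂ) • FA - (4032 : ℂ) • FF - (20736 : ℂ) • FC).mcast (by norm_num) with hT
  have hTapply : ∀ σ : ℍ, T σ = (-E2 (sixMulPt 1 σ) + 3 * E2 (sixMulPt 3 σ) + 25 * E2 (sixMulPt 5 σ) - 75 * E2 (sixMulPt 15 σ)) ^ 2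
      - 2304 * etaQuotient 15 (expFn [(1, 1), (3, 3), (5, 7), (15, -3)]) σ
      + 4032 * etaQuotient 15 (expFn [(1, 2), (3, 2), (5, 2), (15, 2)]) σ
      + 20736 * etaQuotient 15 (expFn [(1, 3), (3, 1), (5, -3), (15, 7)]) σ := by
    intro σ
    simp only [hT, ModularForm.sub_apply, ModularForm.coe_mul, Pi.mul_apply, ModularForm.coe_mcast,
      ModularForm.IsGLPos.smul_apply, smul_eq_mul, hG σ]
    rw [show (FA : ℍ → ℂ) σ = etaQuotient 15 (expFn [(1, 1), (3, 3), (5, 7), (15, -3)]) σ from congrFun hA σ,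
      show (FF : ℍ → ℂ) σ = etaQuotient 15 (expFn [(1, 2), (3, 2), (5, 2), (15, 2)]) σ from congrFun hF σ,
      show (FC : ℍ → ℂ) σ = etaQuotient 15 (expFn [(1, 3), (3, 1), (5, -3), (15, 7)]) σ from congrFun hC σ]
    ring
  have hT0 : (⇑T) = 0 := modularForm_fifteen_four_eq_zero_of_tendsto T (tendsto_L.congr fun σ ↦ by rw [hTapply σ])
  have e := congrFun hT0 τ
  rw [hTapply τ, Pi.zero_apply] at e
  linear_combination e

/-- **`φ₁₅ = η₁η₃η₅η₁₅ = q E₁E₃E₅E₁₅` (the newform of level `15`).** [folklore] -/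
theorem phi15_eq (τ : ℍ) :
    etaQuotient 15 (expFn [(1, 1), (3, 1), (5, 1), (15, 1)]) τ
      = Function.Periodic.qParam 1 (τ : ℂ) * eulerFn 1 τ * eulerFn 3 τ * eulerFn 5 τ * eulerFn 15 τ := by
  rw [etaQuotient_eq_cexp_mul_prod, divisors_fifteen]
  have hsum : (∑ δ ∈ ({1, 3, 5, 15} : Finset ℕ),
      (δ : ℤ) * expFn [(1, 1), (3, 1), (5, 1), (15, 1)] δ) = ((24 * 1 : ℕ) : ℤ) := by decide
  rw [hsum, EulerRemaindersSixtyFour.cexp_eq_qParam_pow, pow_one]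
  rw [Finset.prod_insert (by decide), Finset.prod_insert (by decide), Finset.prod_insert (by decide),
    Finset.prod_singleton]
  rw [show expFn [(1, 1), (3, 1), (5, 1), (15, 1)] 1 = 1 by decide,
    show expFn [(1, 1), (3, 1), (5, 1), (15, 1)] 3 = 1 by decide,
    show expFn [(1, 1), (3, 1), (5, 1), (15, 1)] 5 = 1 by decide,
    show expFn [(1, 1), (3, 1), (5, 1), (15, 1)] 15 = 1 by decide]
  simp only [zpow_one]
  ring

/-- **`G²𝓔 = 576φ₁₅²(4𝓔² − 7𝓔 − 36)` on `ℍ`** with `φ₁₅ = η₁η₃η₅η₁₅` (`A = φ₁₅²𝓔`, `F = φ₁₅²`, `C = φ₁₅²/𝓔` by `η`-exponent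
bookkeeping). [cite: CremonaAlgorithms1997, §2.10] -/
theorem G_sq_mul_E_eq (τ : ℍ) :
    (-E2 (sixMulPt 1 τ) + 3 * E2 (sixMulPt 3 τ) + 25 * E2 (sixMulPt 5 τ) - 75 * E2 (sixMulPt 15 τ)) ^ 2
        * etaQuotient 15 (expFn [(1, -1), (3, 1), (5, 5), (15, -5)]) τ
      = 576 * etaQuotient 15 (expFn [(1, 1), (3, 1), (5, 1), (15, 1)]) τ ^ 2
        * (4 * etaQuotient 15 (expFn [(1, -1), (3, 1), (5, 5), (15, -5)]) τ ^ 2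
          - 7 * etaQuotient 15 (expFn [(1, -1), (3, 1), (5, 5), (15, -5)]) τ - 36) := by
  have hE1 := eulerFn_ne_zero (by norm_num : 0 < 1) τ
  have hE3 := eulerFn_ne_zero (by norm_num : 0 < 3) τ
  have hE5 := eulerFn_ne_zero (by norm_num : 0 < 5) τ
  have hE15 := eulerFn_ne_zero (by norm_num : 0 < 15) τ
  have hq := qParam_ne_zero τ
  rw [G_sq_eq τ, A_eq, F_eq, C_eq, E_eq, phi15_eq]
  field_simp
  ring

end Summit.BirchSwinnertonDyer.BirchSwinnertonDyer.Theorems.ManinLocalTwoThree.EtaIdentityFifteen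

end
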